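import Literature.NumberTheory.ConnesConsani2021.VanishingConditions
import Literature.NumberTheory.ConnesConsani2021.TraceRemainderSmooth
import HarnessLib

/-!
# Connes–Consani 2021, §3 Theorem 3.6 eq. (Qprime), Corollary 3.8, Remark 3.9 (i) — for CC's OWN
# trace-remainder `δ` (the generic-`G` theorems of `JumpFormula` / `VanishingConditions` instantiated at
# `G = δ ∘ exp`), RH-FREE

LABEL (line 1): **RH-FREE corpus literature.**  Theorems only (no definition, no named fact, no instance,
no `sorry`).  A. Connes, C. Consani, *Weil positivity and trace formula, the archimedean place*, Selecta
Math. (N.S.) 27 (2021) 77 = arXiv:2006.13771 [bib: `ConnesConsani2021`], §3 "little square", Theorem 3.6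
(= arXiv Thm. 17, p. 13) eq. (Qprime), Remark 3.7 (= Rem. 18, pp. 13–14), Corollary 3.8 (= Cor. 19, p. 14),
Remark 3.9 (i) (= Rem. 20 (i), p. 14).

**Context.** `JumpFormula.lean` proves (Qprime)/(Eprime) for ANY density `G ∈ C²(ℝ)` (the even function
`k = G ∘ |·|`, `k′(0⁺) = G′(0)`), and `VanishingConditions.lean` (seat t2) types Cor. 3.8 / Rem. 3.9 (i) for
such a generic `G` "modulo the §2 object `δ`" (`cor_3_8_of_numericalInput`, `rem_3_9_i_of_numericalInput`,
binders `hG : ContDiff ℝ 2 G`, `hG1 : deriv G 0 = 1`).  The §2 object is the tree's `traceRemainder`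
(`SchwartzKernels.lean`, seat t1), and `TraceRemainderSmooth.lean` proves that
`G_δ x := traceRemainderAux (eˣ)` (the closed form (25) composed with `exp`) is `C^∞` on `ℝ`, equals
`δ(eˣ)` for `x ≥ 0`, and has `G_δ′(0) = δ′(1⁺) = 1`.  This file plugs `G_δ` in: CC's `D₊` IS
`evenFunctional G_δ`, so the printed statements now hold for CC's actual `δ`, the only remaining
hypotheses being the ones PRINTED as numerical verifications (Cor. 3.8: "`∫₀ˢ Q₊δ(ν(x))dx ≤ 1` for
`s = 0.097542`"; Rem. 3.9 (i): the Boas–Kac bound and "`s = 0.14043`"), floating point in print and not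
re-computed here.  `G_δ` is written out as the lambda `fun x ↦ ((traceRemainderAux (Real.exp x) : ℝ) : ℂ)`
(no new definition).

* `evenFunctional_traceRemainder` — `evenFunctional G_δ F = ∫ F(x) δ(e^{|x|}) dx = D₊(F)` (§3 p. 13);
* **`integral_opQ_mul_traceRemainder` = eq. (Qprime) for CC's `δ`, PROVED**:
  `D₊(Q₊F) = −2F(0) + ∫₀^∞ (F(x) + F(−x)) (Q₊G_δ)(x) dx` for `F ∈ C_c²(ℝ)` ("the sum of `−2δ₀`" — the
  coefficient is `−2δ′(1⁺) = −2` — "and the even function which coincides with `(−∂ₓ²+¼)δ(exp x)` for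
  `x ≥ 0`");
* `cor_3_8_traceRemainder_of_numericalInput`, `rem_3_9_i_traceRemainder_of_numericalInput` — Cor. 3.8 and
  Rem. 3.9 (i) for CC's `δ`, modulo exactly their printed numerical inputs.

Cell `rh-crit`, sub-cell `cc/`, seat t1.  bears_on: W-C/W-P (§3 `D₊`-form; NOT on the path to Thm. 1 /
apex (A) — superseded in range by `isPositiveOn_archW_inter_vanishingIdeal`).  WHAT THIS IS NOT: any
claim about RH; positivity statements at the archimedean place never reach the critical strip; nothing
in this file bears on the truth of RH.

## References
* A. Connes, C. Consani, *Weil positivity and trace formula, the archimedean place*, Selecta Math. (N.S.)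
  27 (2021), Paper No. 77 (arXiv:2006.13771), §3 Thm. 3.6 eq. (Qprime) p. 13, Rem. 3.7 pp. 13–14,
  Cor. 3.8, Rem. 3.9 (i) p. 14. [ConnesConsani2021]
-/

noncomputable section

open MeasureTheory Set Complex Filter
open scoped Real ComplexConjugate

namespace Literature.NumberTheory.ConnesConsani2021

open Literature.NumberTheory.LFunctions

variable {F : ℝ → ℂ}

/-- `G_δ = traceRemainderAux ∘ exp` (as a `ℂ`-valued function) is `C²`. [cite: ConnesConsani2021, §3 Rem. 3.7 pp. 13–14 (arXiv Rem. 18)] -/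
theorem contDiff_two_ofReal_traceRemainderAux_exp :
    ContDiff ℝ 2 (fun x : ℝ ↦ ((traceRemainderAux (Real.exp x) : ℝ) : ℂ)) :=
  contDiff_infty.mp (contDiff_ofReal_traceRemainderAux_exp le_rfl) 2

/-- **CC's `D₊` is `evenFunctional G_δ`**: `evenFunctional G_δ F = ∫ F(x) δ(e^{|x|}) dx`
("`D₊(f) := ∫ f(x) δ(ν(x)) dx`, `ν(x) = exp|x|`", §3 p. 13). [cite: ConnesConsani2021, §3 Thm. 3.6 p. 13 (arXiv Thm. 17)] -/
theorem evenFunctional_traceRemainder (F : ℝ → ℂ) :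
    evenFunctional (fun x : ℝ ↦ ((traceRemainderAux (Real.exp x) : ℝ) : ℂ)) F
      = ∫ x, F x * ((traceRemainder (Real.exp |x|) : ℝ) : ℂ) := by
  simp only [evenFunctional_apply, traceRemainder_exp_abs]

/-- **Connes–Consani 2021, Theorem 3.6, eq. (Qprime) — for CC's `δ`, PROVED.**  "`Q₊δ(ν(x))` is the sum
of `−2δ₀` and the even function which coincides with `(−∂ₓ² + ¼)δ(exp x)` for `x ≥ 0`.  Equivalently
`D₊(Q₊f) = −2f(0) + ∫₀^∞ (f(x) + f(−x)) Q₊δ(exp x) dx`" (§3 p. 13; the coefficient `−2` is `−2δ′(1⁺)`,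
`δ′(1⁺) = 1` by eq. (26)): for `F ∈ C_c²(ℝ)`, with `Q₊ = opQ = −∂ₓ² + ¼` and `G_δ = traceRemainderAux ∘ exp`
(`= δ ∘ exp` on `[0, ∞)`),
`∫ (Q₊F)(x) δ(e^{|x|}) dx = −2F(0) + ∫₀^∞ (F(x) + F(−x)) (Q₊G_δ)(x) dx`.
[cite: ConnesConsani2021, §3 Thm. 3.6 eq. (Qprime) p. 13 (arXiv Thm. 17); Rem. 3.7 pp. 13–14] -/
theorem integral_opQ_mul_traceRemainder (hF : ContDiff ℝ 2 F) (hFs : HasCompactSupport F) :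
    ∫ x, opQ F x * ((traceRemainder (Real.exp |x|) : ℝ) : ℂ)
      = -2 * F 0 + ∫ x in Ioi 0, (F x + F (-x)) *
          opQ (fun x : ℝ ↦ ((traceRemainderAux (Real.exp x) : ℝ) : ℂ)) x := by
  rw [← evenFunctional_traceRemainder, evenFunctional_opQ hF hFs contDiff_two_ofReal_traceRemainderAux_exp,
    deriv_ofReal_traceRemainderAux_exp_zero, mul_one]

/-- **Connes–Consani 2021, Corollary 3.8 — for CC's `δ`, modulo its printed numerical input.**  "One has
`D∘Q ≤ 0` on `C_c^∞(I)`, where `I = [u⁻¹, u]`, `u = 1.10246`.  Proof. … One verifies numerically that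
[`∫₀ˢ Q₊δ(ν(x)) dx ≤ 1`] holds for `s = 0.097542`" (p. 14): with that verification as the hypothesis
`hnum` (floating point in print; here `‖Q₊G_δ‖`, which is what the argument uses), `−D₊∘Q₊` is positive
on `C_c^∞([−s, s])`.  Instance of t2's `cor_3_8_of_numericalInput` at `G = G_δ`.
[cite: ConnesConsani2021, §3 Cor. 3.8 p. 14 (arXiv Cor. 19)] -/
theorem cor_3_8_traceRemainder_of_numericalInput
    (hnum : ∫ x in Ioc 0 (0.097542 : ℝ),
      ‖opQ (fun x : ℝ ↦ ((traceRemainderAux (Real.exp x) : ℝ) : ℂ)) x‖ ≤ 1) :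
    IsPositiveOn (-fun f ↦ evenFunctional (fun x : ℝ ↦ ((traceRemainderAux (Real.exp x) : ℝ) : ℂ)) (opQ f))
      ↑(Yoshida1992.C (0.097542 : ℝ)) :=
  cor_3_8_of_numericalInput contDiff_two_ofReal_traceRemainderAux_exp
    deriv_ofReal_traceRemainderAux_exp_zero hnum

/-- **Connes–Consani 2021, Remark 3.9 (i) — for CC's `δ`, modulo its printed inputs** (the Boas–Kac bound
`hBK` and the numerical verification `hnum` at `s = 0.14043`, p. 14).  Instance of t2's
`rem_3_9_i_of_numericalInput` at `G = G_δ`. [cite: ConnesConsani2021, §3 Rem. 3.9 (i) p. 14 (arXiv Rem. 20 (i))] -/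
theorem rem_3_9_i_traceRemainder_of_numericalInput
    (hBK : ∀ f ∈ (Yoshida1992.C (0.14043 : ℝ) : Set (ℝ → ℂ)), IsPositiveDefinite f →
      ∀ x : ℝ, x ≠ 0 → ‖f x‖ ≤ (f 0).re * Real.cos (π / (⌈(0.14043 : ℝ) / |x|⌉₊ + 1)))
    (hMi : IntegrableOn (fun x ↦
      ‖opQ (fun x : ℝ ↦ ((traceRemainderAux (Real.exp x) : ℝ) : ℂ)) x‖
        * Real.cos (π / (⌈(0.14043 : ℝ) / |x|⌉₊ + 1))) (Ioc 0 (0.14043 : ℝ)))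
    (hnum : ∫ x in Ioc 0 (0.14043 : ℝ),
      ‖opQ (fun x : ℝ ↦ ((traceRemainderAux (Real.exp x) : ℝ) : ℂ)) x‖
        * Real.cos (π / (⌈(0.14043 : ℝ) / |x|⌉₊ + 1)) ≤ 1) :
    IsPositiveOn (-fun f ↦ evenFunctional (fun x : ℝ ↦ ((traceRemainderAux (Real.exp x) : ℝ) : ℂ)) (opQ f))
      ↑(Yoshida1992.C (0.14043 : ℝ)) :=
  rem_3_9_i_of_numericalInput contDiff_two_ofReal_traceRemainderAux_exp
    deriv_ofReal_traceRemainderAux_exp_zero hBK hMi hnum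

end Literature.NumberTheory.ConnesConsani2021

end
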